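import Summits.HodgeConjecture.CorCM.GaloisNormalSylow
import Summits.HodgeConjecture.CorCM.GaloisOddNormalHallSubgroup
import Summits.HodgeConjecture.CorCM.AbelianSixteenSimpleEightfoldsExist
import HarnessLib

/-!
# THE ODD PART OF THE DEGREE OF A GOOD GALOIS CM FIELD: every odd prime divides `[K:ℚ]` at most once, and at most one odd prime
# divides it — unconditionally for primes `≥ 31`, under gen 33's size condition for smaller primes

COR-CM (cell `pub-hodgecm2`), binder seat b04 (gen 38), count-neutral own lane «Galois-CM-type classification».  KERNEL ONLY:
theorems; no definition, no named fact, no `sorry`.  `HC_CM` is neither used nor claimed.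

`K` a Galois CM field; GOOD = every primitive CM type of `K` is nondegenerate (so the Hodge conjecture holds for every power of every
simple abelian variety with CM by `K`); BAD = a simple abelian variety of dimension `[K:ℚ]/2` with CM by `K` carrying an exceptional
Hodge class on a power.  Assembly of gen 38's chain: Sylow `p`-subgroups of `Gal(K/ℚ)` are NORMAL for odd `p` in a GOOD field
(`CorCM/GaloisNormalSylow`: under gen 33's size condition, and for `p ≥ 31` always), a normal Sylow `p`-subgroup of index `≥ 14` has
order `≤ p`, and two non-trivial normal Sylow subgroups at distinct odd primes are fatal (`CorCM/GaloisOddNormalHallSubgroup`).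

* **`padicVal_le_one_of_forall_isNondegenerate_of_ge`** — `p ≥ 31` prime, `[K:ℚ] = pᵃ·r`, `p ∤ r`, `r ≥ 14`, `K` GOOD ⟹ `a ≤ 1`.
* **`exists_simple_degenerate_of_two_primes_ge`** — `p ≠ q` primes `≥ 31`, `[K:ℚ] = pᵃ·qᵇ·r` with `p, q ∤ r`, `a, b ≥ 1`,
  `r ≥ 14` ⟹ `K` is BAD.  So among the primes `≥ 31` AT MOST ONE divides the degree of a GOOD Galois CM field (of `2`-part… any),
  and it divides it exactly once: `[K:ℚ] = 2ⁿ · (primes < 31) · p^{≤ 1}`.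
* `padicVal_le_one_of_forall_isNondegenerate` (+ `…_three`) — the same for every odd `p` under gen 33's size condition
  `[K:ℚ] = 2·pᵃ·m`, `p ∤ m`, `16 ≤ m`, `8p ≤ 2^(m/4)` (`14 ≤ m` for `p = 3`).
* `exists_simple_degenerate_of_two_primes_of_sylow_normal` — the two-prime statement from normality of both Sylow subgroups (any
  source), and `exists_simple_degenerate_of_not_forall_isNondegenerate` — «not GOOD ⟹ BAD» (Shimura's realisation of a primitive type
  by a simple abelian variety + Hazama's exceptional class), used to turn the contrapositive arguments into degenerate varieties.

## References

* [Shimura1998] G. Shimura, *Abelian Varieties with Complex Multiplication and Modular Functions*, §6.2 Thm. 3, §8.2 Prop. 26, §32.10.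
* [Gordon1999HodgeAVSurvey] B. B. Gordon, *A survey of the Hodge conjecture for abelian varieties*, Thm. 6.4, §9.3.
* [Dodson1984] B. Dodson, *The structure of Galois groups of CM-fields*, Trans. AMS 283 (1984), §3.1.1, §4.1, §5.
* [Rotman1995] J. J. Rotman, *An Introduction to the Theory of Groups*, 4th ed., GTM 148, Thm. 4.12, Thm. 7.41.
-/

noncomputable section

open CategoryTheory CategoryTheory.Limits NumberField
open scoped BigOperators

namespace Summit.HodgeConjecture.CorCM.GaloisModels

open Literature.NumberTheory.ComplexMultiplication
open Literature.AlgebraicGeometry.Motives (AbelianVariety CMType)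
open Literature.AlgebraicGeometry.HodgeTheory
open Literature.AlgebraicGeometry.ComplexMultiplication (IsCMTypeRealisation)
open Literature.AlgebraicGeometry.Pohlmann1968
open Literature.Barriers.HodgeConjecture (divisorClassesSpan)
open Summit.HodgeConjecture.CorCM.GaloisRank
open Summit.HodgeConjecture.CorCM.AbelianSixteen (exists_simple_realisation_of_isPrimitive)

/-! ## §1 Not GOOD ⟹ BAD; `p`-adic bookkeeping -/

section Field

variable {K : Type} [Field K] [NumberField K] [IsCMField K] [IsGalois ℚ K]

omit [IsGalois ℚ K] in
/-- **Not GOOD ⟹ BAD**: if some primitive CM type of the Galois CM field `K` is degenerate, then `K` carries a SIMPLE DEGENERATE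
abelian variety of dimension `[K:ℚ]/2` with a rational `(p,p)` class outside the divisor ring on some power (Shimura §6.2 Thm. 3,
§8.2 Prop. 26; Hazama/Gordon Thm. 6.4). [cite: Shimura1998, §6.2 Thm. 3 and §8.2 Prop. 26] [cite: Gordon1999HodgeAVSurvey, Thm. 6.4] -/
theorem exists_simple_degenerate_of_not_forall_isNondegenerate
    (h : ¬ ∀ (Φ : CMType K) (φ : K →+* ℂ), IsPrimitive (ℂ ≃+* ℂ) Φ.1 φ → IsNondegenerate Φ) :
    ∃ (Φ : CMType K) (φ : K →+* ℂ) (X : AbelianVariety ℂ) (ι : 𝓞 K →+* End X)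
      (ϑ : K →+* Module.End ℂ (complexBetti X.X 1)),
      IsPrimitive (ℂ ≃+* ℂ) Φ.1 φ ∧ ¬ IsNondegenerate Φ ∧ IsCMTypeRealisation Φ X ι ϑ ∧ X.IsSimple ∧
      X.dim = Module.finrank ℚ K / 2 ∧
      ∃ n p : ℕ, ∃ x : complexBetti (⨁ fun _ : Fin n => X).X (2 * p), IsRationalClass x ∧
        IsOfHodgeType (⨁ fun _ : Fin n => X).dim (⨁ fun _ : Fin n => X).X (2 * p) p p x ∧
        x ∉ divisorClassesSpan (⨁ fun _ : Fin n => X).X (⨁ fun _ : Fin n => X).dim p := by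
  push Not at h
  obtain ⟨Φ, φ₀, hprim, hdeg⟩ := h
  obtain ⟨A, ι, θ, hA, hs, hdim⟩ := exists_simple_realisation_of_isPrimitive Φ φ₀ hprim
  exact ⟨Φ, φ₀, A, ι, θ, hprim, hdeg, hA, hs, hdim, exists_exceptional_pow_of_not_isNondegenerate φ₀ hprim hdeg hA⟩

end Field

/-- `pᵏ · i = pᵃ · r` with `p ∤ i`, `p ∤ r` ⟹ `k = a` and `i = r`. [folklore] -/
theorem pow_eq_of_mul_eq_of_not_dvd {p k i a r : ℕ} (hp : p.Prime) (h : p ^ k * i = p ^ a * r) (hi : ¬ p ∣ i)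
    (hr : ¬ p ∣ r) : k = a ∧ i = r := by
  have hp0 : 0 < p := hp.pos
  rcases lt_trichotomy k a with hlt | rfl | hgt
  · exfalso
    obtain ⟨d, rfl⟩ := Nat.exists_eq_add_of_lt hlt
    have h1 : p ^ k * i = p ^ k * (p ^ (d + 1) * r) := by rw [h]; ring
    have h2 := Nat.eq_of_mul_eq_mul_left (pow_pos hp0 k) h1
    exact hi ⟨p ^ d * r, by rw [h2]; ring⟩
  · exact ⟨rfl, Nat.eq_of_mul_eq_mul_left (pow_pos hp0 k) h⟩
  · exfalso
    obtain ⟨d, rfl⟩ := Nat.exists_eq_add_of_lt hgt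
    have h1 : p ^ a * r = p ^ a * (p ^ (d + 1) * i) := by rw [← h]; ring
    have h2 := Nat.eq_of_mul_eq_mul_left (pow_pos hp0 a) h1
    exact hr ⟨p ^ d * i, by rw [h2]; ring⟩

section Field

variable {K : Type} [Field K] [NumberField K] [IsCMField K] [IsGalois ℚ K]

omit [IsCMField K] in
/-- The order and index of a Sylow `p`-subgroup of `Gal(K/ℚ)` from `[K:ℚ] = pᵃ·r`, `p ∤ r`. [cite: Rotman1995, Thm. 4.12] -/
theorem card_sylow_eq_of_finrank {p a r : ℕ} [hp : Fact p.Prime] (hdeg : Module.finrank ℚ K = p ^ a * r) (hpr : ¬ p ∣ r)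
    (P : Sylow p (K ≃ₐ[ℚ] K)) :
    Nat.card (P : Subgroup (K ≃ₐ[ℚ] K)) = p ^ a ∧ (P : Subgroup (K ≃ₐ[ℚ] K)).index = r := by
  obtain ⟨k, hk⟩ := P.isPGroup'.exists_card_eq
  have h : p ^ k * (P : Subgroup (K ≃ₐ[ℚ] K)).index = p ^ a * r := by
    rw [← hk, Subgroup.card_mul_index, IsGalois.card_aut_eq_finrank, hdeg]
  obtain ⟨hka, hir⟩ := pow_eq_of_mul_eq_of_not_dvd hp.out h P.not_dvd_index hpr
  exact ⟨by rw [hk, hka], hir⟩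

/-- From `|P| ∈ {1, p}` and `|P| = pᵃ`: `a ≤ 1`. [folklore] -/
theorem le_one_of_pow_eq {p a : ℕ} (hp : p.Prime) (h : p ^ a = 1 ∨ p ^ a = p) : a ≤ 1 := by
  rcases h with h | h
  · rcases a with _ | a
    · exact Nat.zero_le 1
    · exfalso
      have : p ≤ p ^ (a + 1) := Nat.le_self_pow (Nat.succ_ne_zero a) p
      rw [h] at this
      exact absurd this (not_le.2 hp.one_lt)
  · have : a = 1 := Nat.pow_right_injective hp.two_le (by simpa using h)
    omega

/-! ## §2 One odd prime: the `p`-part of `[K:ℚ]` is at most `p` -/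

/-- **`p ≥ 31`: `p²` does not divide the degree of a GOOD Galois CM field** (`[K:ℚ] = pᵃ·r`, `p ∤ r`, `r ≥ 14` ⟹ `a ≤ 1`): the
Sylow `p`-subgroup is normal (gen 38, no size hypothesis) and a normal Sylow `p`-subgroup of index `≥ 14` of a GOOD field has order
`≤ p`. [cite: Shimura1998, §8.2 Prop. 26 and §32.10] [cite: Dodson1984, §3.1.1 and §5] [cite: Rotman1995, Thm. 4.12 and Thm. 7.41] -/
theorem padicVal_le_one_of_forall_isNondegenerate_of_ge {p a r : ℕ} [hp : Fact p.Prime] (h31 : 31 ≤ p)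
    (hdeg : Module.finrank ℚ K = p ^ a * r) (hpr : ¬ p ∣ r) (h14 : 14 ≤ r)
    (hgood : ∀ (Φ : CMType K) (φ : K →+* ℂ), IsPrimitive (ℂ ≃+* ℂ) Φ.1 φ → IsNondegenerate Φ) : a ≤ 1 := by
  classical
  have hp2 : p ≠ 2 := by omega
  obtain ⟨P⟩ := (inferInstance : Nonempty (Sylow p (K ≃ₐ[ℚ] K)))
  haveI := sylow_normal_of_forall_isNondegenerate_of_ge p h31 hgood P
  obtain ⟨hcard, hidx⟩ := card_sylow_eq_of_finrank hdeg hpr P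
  have h := card_sylow_le_of_normal hp2 P (by rw [hidx]; exact h14) hgood
  rw [hcard] at h
  exact le_one_of_pow_eq hp.out h

/-- **Odd `p` under gen 33's size condition: `p²` does not divide the degree of a GOOD Galois CM field** (`[K:ℚ] = 2·pᵃ·m`,
`p ∤ m`, `16 ≤ m`, `8p ≤ 2^(m/4)` ⟹ `a ≤ 1`). [cite: Shimura1998, §8.2 Prop. 26 and §32.10] [cite: Dodson1984, §3.1.1 and §5]
[cite: Rotman1995, Thm. 4.12 and Thm. 7.41] -/
theorem padicVal_le_one_of_forall_isNondegenerate {p a m : ℕ} [hp : Fact p.Prime] (hp2 : p ≠ 2)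
    (hdeg : Module.finrank ℚ K = 2 * p ^ a * m) (hpm : ¬ p ∣ m) (hm : 16 ≤ m) (h8 : 8 * p ≤ 2 ^ (m / 4))
    (hgood : ∀ (Φ : CMType K) (φ : K →+* ℂ), IsPrimitive (ℂ ≃+* ℂ) Φ.1 φ → IsNondegenerate Φ) : a ≤ 1 := by
  classical
  obtain ⟨P⟩ := (inferInstance : Nonempty (Sylow p (K ≃ₐ[ℚ] K)))
  haveI := sylow_normal_of_forall_isNondegenerate p a m hp2 hdeg hpm hm h8 hgood P
  have hdeg' : Module.finrank ℚ K = p ^ a * (2 * m) := by rw [hdeg]; ring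
  have hp2m : ¬ p ∣ 2 * m := fun h => by
    rcases (Nat.Prime.dvd_mul hp.out).1 h with h | h
    · exact hp2 ((Nat.prime_dvd_prime_iff_eq hp.out Nat.prime_two).1 h)
    · exact hpm h
  obtain ⟨hcard, hidx⟩ := card_sylow_eq_of_finrank hdeg' hp2m P
  have h := card_sylow_le_of_normal hp2 P (by rw [hidx]; omega) hgood
  rw [hcard] at h
  exact le_one_of_pow_eq hp.out h

/-- **`p = 3`**: `[K:ℚ] = 2·3ᵃ·m`, `3 ∤ m`, `14 ≤ m`, `K` GOOD ⟹ `a ≤ 1` (`9 ∤ [K:ℚ]`). [cite: Shimura1998, §8.2 Prop. 26 and §32.10]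
[cite: Dodson1984, §3.1.1 and §5] [cite: Rotman1995, Thm. 4.12 and Thm. 7.41] -/
theorem padicVal_three_le_one_of_forall_isNondegenerate {a m : ℕ} (hdeg : Module.finrank ℚ K = 2 * 3 ^ a * m)
    (h3m : ¬ 3 ∣ m) (hm : 14 ≤ m)
    (hgood : ∀ (Φ : CMType K) (φ : K →+* ℂ), IsPrimitive (ℂ ≃+* ℂ) Φ.1 φ → IsNondegenerate Φ) : a ≤ 1 := by
  classical
  haveI : Fact (Nat.Prime 3) := ⟨Nat.prime_three⟩
  obtain ⟨P⟩ := (inferInstance : Nonempty (Sylow 3 (K ≃ₐ[ℚ] K)))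
  haveI := sylow_three_normal_of_forall_isNondegenerate a m hdeg h3m hm hgood P
  have hdeg' : Module.finrank ℚ K = 3 ^ a * (2 * m) := by rw [hdeg]; ring
  have hp2m : ¬ 3 ∣ 2 * m := fun h => by
    rcases (Nat.Prime.dvd_mul Nat.prime_three).1 h with h | h
    · exact absurd h (by norm_num)
    · exact h3m h
  obtain ⟨hcard, hidx⟩ := card_sylow_eq_of_finrank hdeg' hp2m P
  have h := card_sylow_le_of_normal (p := 3) (by norm_num) P (by rw [hidx]; omega) hgood
  rw [hcard] at h
  exact le_one_of_pow_eq Nat.prime_three h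

/-! ## §3 Two odd primes -/

/-- **TWO ODD PRIMES WITH NORMAL SYLOW SUBGROUPS ARE FATAL (field form).**  `[K:ℚ] = pᵃ·qᵇ·r` with `p ≠ q` odd primes, `p, q ∤ r`,
`a, b ≥ 1`, `r ≥ 14`; if all Sylow `p`- and `q`-subgroups of `Gal(K/ℚ)` are normal, then `K` carries a SIMPLE DEGENERATE abelian variety
of dimension `[K:ℚ]/2`. [cite: Shimura1998, §6.2 Thm. 3 and §8.2 Prop. 26] [cite: Gordon1999HodgeAVSurvey, Thm. 6.4 and §9.3]
[cite: Dodson1984, §3.1.1 and §4.1] [cite: Rotman1995, Thm. 4.12 and Thm. 7.41] -/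
theorem exists_simple_degenerate_of_two_primes_of_sylow_normal {p q a b r : ℕ} [hp : Fact p.Prime] [hq : Fact q.Prime]
    (hp2 : p ≠ 2) (hq2 : q ≠ 2) (hpq : p ≠ q) (hdeg : Module.finrank ℚ K = p ^ a * q ^ b * r) (hpr : ¬ p ∣ r) (hqr : ¬ q ∣ r)
    (ha : 1 ≤ a) (hb : 1 ≤ b) (h14 : 14 ≤ r) (hP : ∀ P : Sylow p (K ≃ₐ[ℚ] K), (P : Subgroup (K ≃ₐ[ℚ] K)).Normal)
    (hQ : ∀ Q : Sylow q (K ≃ₐ[ℚ] K), (Q : Subgroup (K ≃ₐ[ℚ] K)).Normal) :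
    ∃ (Φ : CMType K) (φ : K →+* ℂ) (X : AbelianVariety ℂ) (ι : 𝓞 K →+* End X)
      (ϑ : K →+* Module.End ℂ (complexBetti X.X 1)),
      IsPrimitive (ℂ ≃+* ℂ) Φ.1 φ ∧ ¬ IsNondegenerate Φ ∧ IsCMTypeRealisation Φ X ι ϑ ∧ X.IsSimple ∧
      X.dim = Module.finrank ℚ K / 2 ∧
      ∃ n p : ℕ, ∃ x : complexBetti (⨁ fun _ : Fin n => X).X (2 * p), IsRationalClass x ∧
        IsOfHodgeType (⨁ fun _ : Fin n => X).dim (⨁ fun _ : Fin n => X).X (2 * p) p p x ∧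
        x ∉ divisorClassesSpan (⨁ fun _ : Fin n => X).X (⨁ fun _ : Fin n => X).dim p := by
  classical
  have hpp := hp.out
  have hqq := hq.out
  obtain ⟨P⟩ := (inferInstance : Nonempty (Sylow p (K ≃ₐ[ℚ] K)))
  obtain ⟨Q⟩ := (inferInstance : Nonempty (Sylow q (K ≃ₐ[ℚ] K)))
  haveI := hP P
  haveI := hQ Q
  -- orders and indices
  have hpqr : ¬ p ∣ q ^ b * r := fun h => by
    rcases (Nat.Prime.dvd_mul hpp).1 h with h | h
    · exact hpq ((Nat.prime_dvd_prime_iff_eq hpp hqq).1 (hpp.dvd_of_dvd_pow h))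
    · exact hpr h
  have hqpr : ¬ q ∣ p ^ a * r := fun h => by
    rcases (Nat.Prime.dvd_mul hqq).1 h with h | h
    · exact hpq ((Nat.prime_dvd_prime_iff_eq hqq hpp).1 (hqq.dvd_of_dvd_pow h)).symm
    · exact hqr h
  obtain ⟨hcardP, -⟩ := card_sylow_eq_of_finrank (by rw [hdeg]; ring : Module.finrank ℚ K = p ^ a * (q ^ b * r)) hpqr P
  obtain ⟨hcardQ, -⟩ := card_sylow_eq_of_finrank (by rw [hdeg]; ring : Module.finrank ℚ K = q ^ b * (p ^ a * r)) hqpr Q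
  have hP1 : (P : Subgroup (K ≃ₐ[ℚ] K)) ≠ ⊥ := fun h => by
    have h1 := (Subgroup.eq_bot_iff_card _).1 h
    rw [hcardP] at h1
    have : p ≤ p ^ a := Nat.le_self_pow (by omega) p
    rw [h1] at this
    exact absurd this (not_le.2 hpp.one_lt)
  have hQ1 : (Q : Subgroup (K ≃ₐ[ℚ] K)) ≠ ⊥ := fun h => by
    have h1 := (Subgroup.eq_bot_iff_card _).1 h
    rw [hcardQ] at h1
    have : q ≤ q ^ b := Nat.le_self_pow (by omega) q
    rw [h1] at this
    exact absurd this (not_le.2 hqq.one_lt)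
  -- `[Gal : PQ] = r`
  have hcopPQ : Nat.Coprime (Nat.card (P : Subgroup (K ≃ₐ[ℚ] K))) (Nat.card (Q : Subgroup (K ≃ₐ[ℚ] K))) := by
    rw [hcardP, hcardQ]
    exact Nat.Coprime.pow _ _ ((Nat.coprime_primes hpp hqq).2 hpq)
  have hcardN := card_sup_eq_mul_of_coprime (P : Subgroup (K ≃ₐ[ℚ] K)) (Q : Subgroup (K ≃ₐ[ℚ] K)) hcopPQ
  have hidx : ((P : Subgroup (K ≃ₐ[ℚ] K)) ⊔ (Q : Subgroup (K ≃ₐ[ℚ] K))).index = r := by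
    have h := Subgroup.card_mul_index ((P : Subgroup (K ≃ₐ[ℚ] K)) ⊔ (Q : Subgroup (K ≃ₐ[ℚ] K)))
    rw [IsGalois.card_aut_eq_finrank, hdeg, hcardN, hcardP, hcardQ] at h
    exact Nat.eq_of_mul_eq_mul_left (Nat.mul_pos (pow_pos hpp.pos a) (pow_pos hqq.pos b)) h
  -- GOOD would force `P = 1` or `Q = 1`
  refine exists_simple_degenerate_of_not_forall_isNondegenerate fun hgood => ?_
  rcases sylow_eq_bot_or_of_normal hp2 hq2 hpq P Q (by rw [hidx]; exact h14) hgood with h | h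
  · exact hP1 h
  · exact hQ1 h

/-- **TWO PRIMES `≥ 31` CANNOT BOTH DIVIDE THE DEGREE OF A GOOD GALOIS CM FIELD**: `p ≠ q` primes `≥ 31`, `[K:ℚ] = pᵃ·qᵇ·r`,
`p, q ∤ r`, `a, b ≥ 1`, `r ≥ 14` ⟹ `K` carries a SIMPLE DEGENERATE abelian variety of dimension `[K:ℚ]/2` — no size hypothesis beyond
`r ≥ 14`. [cite: Shimura1998, §6.2 Thm. 3 and §8.2 Prop. 26] [cite: Gordon1999HodgeAVSurvey, Thm. 6.4 and §9.3]
[cite: Dodson1984, §3.1.1, §4.1 and §5] [cite: Rotman1995, Thm. 4.12 and Thm. 7.41] -/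
theorem exists_simple_degenerate_of_two_primes_ge {p q a b r : ℕ} [Fact p.Prime] [Fact q.Prime] (hp : 31 ≤ p)
    (hq : 31 ≤ q) (hpq : p ≠ q) (hdeg : Module.finrank ℚ K = p ^ a * q ^ b * r) (hpr : ¬ p ∣ r) (hqr : ¬ q ∣ r)
    (ha : 1 ≤ a) (hb : 1 ≤ b) (h14 : 14 ≤ r) :
    ∃ (Φ : CMType K) (φ : K →+* ℂ) (X : AbelianVariety ℂ) (ι : 𝓞 K →+* End X)
      (ϑ : K →+* Module.End ℂ (complexBetti X.X 1)),
      IsPrimitive (ℂ ≃+* ℂ) Φ.1 φ ∧ ¬ IsNondegenerate Φ ∧ IsCMTypeRealisation Φ X ι ϑ ∧ X.IsSimple ∧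
      X.dim = Module.finrank ℚ K / 2 ∧
      ∃ n p : ℕ, ∃ x : complexBetti (⨁ fun _ : Fin n => X).X (2 * p), IsRationalClass x ∧
        IsOfHodgeType (⨁ fun _ : Fin n => X).dim (⨁ fun _ : Fin n => X).X (2 * p) p p x ∧
        x ∉ divisorClassesSpan (⨁ fun _ : Fin n => X).X (⨁ fun _ : Fin n => X).dim p := by
  classical
  by_cases hgood : ∀ (Φ : CMType K) (φ : K →+* ℂ), IsPrimitive (ℂ ≃+* ℂ) Φ.1 φ → IsNondegenerate Φ
  · exact exists_simple_degenerate_of_two_primes_of_sylow_normal (by omega) (by omega) hpq hdeg hpr hqr ha hb h14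
      (fun P => sylow_normal_of_forall_isNondegenerate_of_ge p hp hgood P)
      (fun Q => sylow_normal_of_forall_isNondegenerate_of_ge q hq hgood Q)
  · exact exists_simple_degenerate_of_not_forall_isNondegenerate hgood

/-- **GOOD ⟹ among the primes `≥ 31` at most one divides `[K:ℚ]`** (given `[K:ℚ] = pᵃ·qᵇ·r`, `p, q ∤ r`, `r ≥ 14`: `a = 0 ∨ b = 0`).
[cite: Shimura1998, §8.2 Prop. 26] [cite: Dodson1984, §3.1.1 and §5] -/
theorem eq_zero_or_eq_zero_of_two_primes_ge {p q a b r : ℕ} [Fact p.Prime] [Fact q.Prime] (hp : 31 ≤ p) (hq : 31 ≤ q)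
    (hpq : p ≠ q) (hdeg : Module.finrank ℚ K = p ^ a * q ^ b * r) (hpr : ¬ p ∣ r) (hqr : ¬ q ∣ r) (h14 : 14 ≤ r)
    (hgood : ∀ (Φ : CMType K) (φ : K →+* ℂ), IsPrimitive (ℂ ≃+* ℂ) Φ.1 φ → IsNondegenerate Φ) : a = 0 ∨ b = 0 := by
  by_contra h
  push Not at h
  obtain ⟨Φ, φ, X, ι, ϑ, H1, H2, -⟩ :=
    exists_simple_degenerate_of_two_primes_ge hp hq hpq hdeg hpr hqr (Nat.one_le_iff_ne_zero.2 h.1)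
      (Nat.one_le_iff_ne_zero.2 h.2) h14
  exact H2 (hgood Φ φ H1)

end Field

end Summit.HodgeConjecture.CorCM.GaloisModels

end
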